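import Literature.NumberTheory.Transcendental.KZCalculus
import Literature.NumberTheory.Transcendental.KZProductIdeal
import Literature.NumberTheory.Transcendental.KZExpCalculus
import Summits.KontsevichZagierPeriods.KontsevichZagierPeriods.Theorems.TerasomaMultiplicationBetaCancellationStubCatalystAlgebraicPoint

/-!
# `BetaCancellation` (stmt-KontsevichZagierPeriods-13633), line `dirichlet-companion-to-pi` — stub `stub_liftP_injective`

**The lift of a pinned-product family over a catalyst of non-zero value is injective on `FormalRep`.**
Let `p = [K, f]` be an integral representation of dimension `d` with `p.value ≠ 0` (the *catalyst*)
and let `P n r` (`r : IntegralRep n`) be pinned products `p ⊗ r` in the crux's coordinates: the domain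
of `P n r` is `{z | head z ∈ K ∧ tail z ∈ r.domain}` and its integrand is `z ↦ f (head z) · g (tail z)`
(`g = r.integrand`), where `head z = z ∘ Fin.castAdd n`, `tail z = z ∘ Fin.natAdd d`. Then the additive
map `L = FreeAbelianGroup.lift (s ↦ [P s.1 s.2]) : FormalRep →+ FormalRep` is injective.

Proof. (1) Each `P n` is injective: pick `x₀ ∈ K` with `f x₀ ≠ 0` (`stub_catalyst_algebraicPoint`,
which needs `p.value ≠ 0`). Reading the domain of `P n r` at the points `Fin.append x₀ w` gives
`w ∈ r.domain ↔ Fin.append x₀ w ∈ (P n r).domain`, and reading the integrand there gives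
`f x₀ · r.integrand w`; so `P n r = P n r'` forces equal domains and (cancelling `f x₀ ≠ 0`) equal
integrands, hence `r = r'` (`KZ.IntegralRep.ext'`). (2) Hence the generator map
`g : ⟨n, r⟩ ↦ ⟨d + n, P n r⟩` of `Σ n, IntegralRep n` is injective (`d + n = d + m` gives `n = m`).
(3) `L` is by definition `FreeAbelianGroup.map g`, and `FreeAbelianGroup.map` of an injective map is
injective (`freeAbelianGroup_map_injective`, transport to `Finsupp.mapDomain`). No definitions;
sorry-free; axioms ⊆ {propext, Classical.choice, Quot.sound}.

References: M. Kontsevich, D. Zagier, *Periods* (2001), §1.2 (the formal group of integral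
representations); free-abelian-group bookkeeping is folklore.
-/

noncomputable section

-- `Summit.KontsevichZagierPeriods.KontsevichZagierPeriods.…` is the tree's mandated layout (single-conjunct summit).
set_option linter.dupNamespace false

namespace Summit.KontsevichZagierPeriods.KontsevichZagierPeriods.BetaCancellationLine

open Literature.NumberTheory.Transcendental
open Literature.NumberTheory.Transcendental.KZ

/-! ### Pinning by a catalyst of non-zero value is injective -/

/-- A pinned-product family `r ↦ P n r = p ⊗ r` over a catalyst `p` of non-zero value is injective in
each dimension `n`: at a catalyst point `x₀ ∈ p.domain` with `p.integrand x₀ ≠ 0`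
(`stub_catalyst_algebraicPoint`) the domain and the integrand of `r` are read off those of `P n r`
along the slice `w ↦ Fin.append x₀ w`. [folklore] -/
theorem pinnedProduct_injective {d : ℕ} (p : IntegralRep d) (hp : p.value ≠ 0)
    (P : ∀ n : ℕ, IntegralRep n → IntegralRep (d + n))
    (hPd : ∀ (n : ℕ) (r : IntegralRep n), (P n r).domain =
      {z | (fun i => z (Fin.castAdd n i)) ∈ p.domain ∧ (fun j => z (Fin.natAdd d j)) ∈ r.domain})
    (hPi : ∀ (n : ℕ) (r : IntegralRep n), (P n r).integrand =
      fun z => p.integrand (fun i => z (Fin.castAdd n i)) * r.integrand (fun j => z (Fin.natAdd d j)))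
    (n : ℕ) : Function.Injective (P n) := by
  obtain ⟨x₀, hx₀, -, hpx₀⟩ := stub_catalyst_algebraicPoint p hp
  intro r r' h
  refine IntegralRep.ext' ?_ ?_
  · ext w
    have h1 : Fin.append x₀ w ∈ (P n r).domain ↔ Fin.append x₀ w ∈ (P n r').domain := by rw [h]
    simp only [hPd, Set.mem_setOf_eq, Fin.append_left, Fin.append_right] at h1
    exact ⟨fun hw => (h1.1 ⟨hx₀, hw⟩).2, fun hw => (h1.2 ⟨hx₀, hw⟩).2⟩
  · funext w
    have h2 := congrFun (hPi n r) (Fin.append x₀ w)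
    have h3 := congrFun (hPi n r') (Fin.append x₀ w)
    rw [h] at h2
    rw [h2] at h3
    simp only [Fin.append_left, Fin.append_right] at h3
    exact mul_left_cancel₀ hpx₀ h3

/-- The generator map `⟨n, r⟩ ↦ ⟨d + n, P n r⟩` of `Σ n, IntegralRep n` induced by a pinned-product
family over a catalyst of non-zero value is injective: equal images have equal dimensions
(`d + n = d + m ⇒ n = m`) and then equal bases (`pinnedProduct_injective`). [folklore] -/
theorem sigmaPinnedProduct_injective {d : ℕ} (p : IntegralRep d) (hp : p.value ≠ 0)
    (P : ∀ n : ℕ, IntegralRep n → IntegralRep (d + n))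
    (hPd : ∀ (n : ℕ) (r : IntegralRep n), (P n r).domain =
      {z | (fun i => z (Fin.castAdd n i)) ∈ p.domain ∧ (fun j => z (Fin.natAdd d j)) ∈ r.domain})
    (hPi : ∀ (n : ℕ) (r : IntegralRep n), (P n r).integrand =
      fun z => p.integrand (fun i => z (Fin.castAdd n i)) * r.integrand (fun j => z (Fin.natAdd d j))) :
    Function.Injective
      (fun s : (Σ n, IntegralRep n) => (⟨d + s.1, P s.1 s.2⟩ : Σ n, IntegralRep n)) := by
  rintro ⟨n, r⟩ ⟨m, r'⟩ h
  simp only [Sigma.mk.inj_iff] at h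
  obtain ⟨h1, h2⟩ := h
  obtain rfl : n = m := Nat.add_left_cancel h1
  obtain rfl : r = r' := pinnedProduct_injective p hp P hPd hPi n (eq_of_heq h2)
  rfl

/-! ### The stub -/

/-- STUB (seat c14, cycle 3). `lift (of ∘ P)` is injective on `FormalRep` for a pinned-product family
over a catalyst of non-zero value: `P n` is injective (domain and integrand of `r` are read off
`P n r` at a catalyst point where `p.integrand ≠ 0`), so the induced map of generators
`⟨n, r⟩ ↦ ⟨d + n, P n r⟩` is injective, and `FreeAbelianGroup.map` of an injective map is injective.
[folklore] -/
theorem stub_liftP_injective {d : ℕ} (p : IntegralRep d) (hp : p.value ≠ 0)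
    (P : ∀ n : ℕ, IntegralRep n → IntegralRep (d + n))
    (hPd : ∀ (n : ℕ) (r : IntegralRep n), (P n r).domain =
      {z | (fun i => z (Fin.castAdd n i)) ∈ p.domain ∧ (fun j => z (Fin.natAdd d j)) ∈ r.domain})
    (hPi : ∀ (n : ℕ) (r : IntegralRep n), (P n r).integrand =
      fun z => p.integrand (fun i => z (Fin.castAdd n i)) * r.integrand (fun j => z (Fin.natAdd d j))) :
    Function.Injective
      (FreeAbelianGroup.lift (fun s : (Σ n, IntegralRep n) => of (P s.1 s.2))) := by
  have key : FreeAbelianGroup.lift (fun s : (Σ n, IntegralRep n) => of (P s.1 s.2)) =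
      FreeAbelianGroup.map
        (fun s : (Σ n, IntegralRep n) => (⟨d + s.1, P s.1 s.2⟩ : Σ n, IntegralRep n)) :=
    rfl
  rw [key]
  exact freeAbelianGroup_map_injective (sigmaPinnedProduct_injective p hp P hPd hPi)

end Summit.KontsevichZagierPeriods.KontsevichZagierPeriods.BetaCancellationLine

end
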